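import Mathlib.RepresentationTheory.Basic
import Mathlib.Data.Complex.Basic
import Mathlib.Topology.Algebra.Group.Basic
import Mathlib.Tactic.Module
import Mathlib.Tactic.LinearCombination
import HarnessLib

/-!
# The jet extension of a Jacquet module over the dual numbers: an `M`-equivariant `ε`-linear RETRACTION onto its open-cell part
# («the geometric lemma over `ℂ[ε]∕ε²` splits when the closed-cell quotient is semisimple and `M` has additive rank one»)

Generic representation theory over `ℂ` (any group `M` with a topology), Mathlib-only, THEOREMS ONLY (no `def`, no instance, no
named fact).  This is the abstract `M`-module algebra behind the construction of the first-order jet of a normalised intertwining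
operator BY FROBENIUS RECIPROCITY (consumer: the jet intertwiner of the K4′ cell of `pub/hodgecm-mathlib`, crux H413).

THE SITUATION.  `F` is (the carrier of) the normalised Jacquet module `r_P(X⁺)` of the jet module `X⁺ = i_P(N₀⁺)` of a principal
series `i_P(χ)` along an unramified twist `s ↦ χν^s` (`N₀⁺ = χ ⊗ [[1, 0],[λ, 1]]`, `λ` the additive derivative), read ABSTRACTLY through
five pieces of data: the `M`-action `r`, the character `χ : M →* ℂ` with `λ : M → ℂ` additive, the closed-cell functional
`ev : F → ℂ × ℂ` (evaluation at `1`; it intertwines `r` with `N₀⁺`, written out in coordinates), the nilpotent `ε`-operator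
`e : F → F` (`e² = 0`, commuting with `r`, lying over `E (w₁, w₂) = (0, w₁)`), and the OPEN-CELL PART `ℓ = ker ev` together with an
`ε`-linear `M`-isomorphism `θ : ℓ ≃ ℂ × ℂ` onto the OPPOSITE jet `N₀⁻ = χ ⊗ [[1, 0],[−λ, 1]]` (hypotheses `hθM`, `hθE` — the geometric
lemma for `ℂ²`-valued sections, [BernsteinZelevinsky1977, 2.12], [Casselman1995, Thm. 6.3.5, Lemma 7.1.1 (a)], supplied in the tree by
`SmoothIndOpenCellHaarIntertwiner`).  So `F` is an extension `0 → N₀⁻ → F → N₀⁺ → 0` of `ℂ[ε][M]`-modules.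
* §1 bookkeeping: `ℓ` is `r`- and `e`-stable; **`r(m) s = χ(m) s − λ(m)χ(m) e s` on `ℓ`** (`jacquet_apply_of_mem_openCell`, from `θ`).
* §2 **THE SECTION** (`exists_jet_section`): if the reduction `F ∕ eF` is `χ`-ISOTYPIC (`hss : r(m) x − χ(m) x ∈ eF` — in the application
  `F∕eF = r_P(i_P χ)` and this is the semisimplicity forced by the reducibility `i_P(χ) = π⁺ ⊕ π⁻`), `F` is smooth (`hsm`) and every
  additive character of `M` vanishing on an open subgroup is a multiple of `λ` (`hrank`, «additive rank one»), then `ev` has an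
  `M`-EQUIVARIANT `ε`-LINEAR SECTION: a vector `q` with `ev q = (1, 0)` and `r(m) q = χ(m)(q + λ(m) e q)`.  Proof: for any lift `x₁` of
  `(1, 0)` the defect `r(m)x₁ − χ(m)(x₁ + λ(m) e x₁)` lies in `ℓ ∩ eF = eℓ`, hence is `χ(m)β(m) · e s₀` (`s₀ = θ⁻¹(1, 0)`); `β` is additive
  (expand `r(mm′)`), vanishes on the stabiliser of `x₁`, so `β = c λ`, and `q := x₁ + (c∕2) s₀` works — the «shear by `c∕2`».
* §3 **THE RETRACTION** (`exists_jet_retraction`): `φ := θ ∘ (1 − L ∘ ev)` with `L (w₁, w₂) = w₁ q + w₂ e q` is an `M`-equivariant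
  (`φ ∘ r(m) = N₀⁻(m) ∘ φ`), `ε`-linear (`φ ∘ e = E ∘ φ`) map `F → ℂ × ℂ` extending `θ` — the Frobenius datum of the jet intertwiner.
* §4 **RIGIDITY** (`fst_eq_mul_fst_of_jet_linear`): every `M`-equivariant `ε`-linear `ψ : F → N₀⁺` has first row a MULTIPLE OF `ev`
  (`(ψ x).1 = r₀ (ev x).1`): on `ℓ ≅ N₀⁻` an `ε`-linear `M`-map `N₀⁻ → N₀⁺` has `2λ(m₀)χ(m₀) E ψ = 0`, so it lands in `εN₀⁺` (needs
  `λ(m₀) ≠ 0` and `2 ≠ 0`) — «`Hom_{ℂ[ε][M]}(J⁻, J⁺) ⊆ ε`».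
* §5 **NO LIFT** (`fst_eq_zero_of_jacquet_isotypic`): an `M`-map from a `χ`-ISOTYPIC module to `N₀⁺` lands in `εN₀⁺ = 0 × ℂ` — the
  Frobenius shadow of «`i_P(χ)` does not lift into `i_P(N₀⁺)`».
These are the formal (`ℂ[ε]∕ε²`) shadows of the construction of intertwining operators as RATIONAL functions via uniqueness of
Jacquet-module functionals ([Keys1984, §3 pp. 118–119] for `U(2,1)`; [Casselman1995, §6.4]; [BernsteinZelevinsky1977, §2.3, 2.12]);
the file is self-contained linear algebra and cites these as the locus of its consumer.

## References
* [BernsteinZelevinsky1977] I. N. Bernstein, A. V. Zelevinsky, *Induced representations of reductive p-adic groups I*, Ann. Sci. ÉNS 10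
  (1977), §2.3 and Geometrical Lemma 2.12.
* [Casselman1995] W. Casselman, *Introduction to the theory of admissible representations of p-adic reductive groups* (1995), §6.3
  (Thm. 6.3.5), §6.4, Lemma 7.1.1 (a).
* [Keys1984] D. Keys, *Principal series representations of special unitary groups over local fields*, Compositio Math. 51 (1984), §3
  pp. 118–119.
-/

set_option autoImplicit false

namespace Literature.RepresentationTheory

section JetExtension

variable {M : Type*} [Group M] [TopologicalSpace M] {F : Type*} [AddCommGroup F] [Module ℂ F]
  (r : Representation ℂ M F) (χ : M →* ℂ) (lam : M → ℂ) (ev : F →ₗ[ℂ] ℂ × ℂ) (e : F →ₗ[ℂ] F)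
  (ℓ : Submodule ℂ F) (hℓ : ∀ x, x ∈ ℓ ↔ ev x = 0)

/-! ## §1 Bookkeeping: the open-cell part `ℓ = ker ev` is `r`- and `e`-stable; the action on `ℓ` read through `θ` -/

omit [TopologicalSpace M] in
include hℓ in
/-- `ℓ = ker ev` is stable under `r(m)`, because `ev` intertwines `r` with the jet character `N₀⁺(m) (w₁, w₂) = (χ w₁, λχ w₁ + χ w₂)`.
[cite: Casselman1995, §6.3] [cite: BernsteinZelevinsky1977, §2.3] -/
theorem apply_mem_openCell_of_mem
    (hev : ∀ (m : M) (x : F), ev (r m x) = (χ m * (ev x).1, lam m * (χ m * (ev x).1) + χ m * (ev x).2))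
    (m : M) {x : F} (hx : x ∈ ℓ) : r m x ∈ ℓ := by
  rw [hℓ] at hx ⊢
  rw [hev, hx]
  simp

omit [TopologicalSpace M] in
include hℓ in
/-- `ℓ = ker ev` is stable under the `ε`-operator `e`, because `ev ∘ e = E ∘ ev` with `E (w₁, w₂) = (0, w₁)`.
[cite: BernsteinZelevinsky1977, §2.3] -/
theorem e_mem_openCell_of_mem (heev : ∀ x : F, ev (e x) = (0, (ev x).1)) {x : F} (hx : x ∈ ℓ) : e x ∈ ℓ := by
  rw [hℓ] at hx ⊢
  rw [heev, hx]
  simp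

omit [TopologicalSpace M] in
include hℓ in
/-- **THE JACQUET ACTION ON THE OPEN-CELL PART, READ THROUGH `θ`**: if `θ : ℓ ≃ ℂ × ℂ` intertwines `r|_ℓ` with the opposite jet
`N₀⁻(m) (w₁, w₂) = (χ w₁, −λχ w₁ + χ w₂)` (`hθM`) and `e|_ℓ` with `E` (`hθE`), then for every `s ∈ ℓ`:
`r(m) s = χ(m) • s − (λ(m)χ(m)) • e s` — `M` acts on the open-cell part by the character `χ(1 − ελ)` of `ℂ[ε]∕ε²`.
[cite: Casselman1995, Lemma 7.1.1 (a)] [cite: BernsteinZelevinsky1977, Geometrical Lemma 2.12] -/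
theorem jacquet_apply_of_mem_openCell
    (hev : ∀ (m : M) (x : F), ev (r m x) = (χ m * (ev x).1, lam m * (χ m * (ev x).1) + χ m * (ev x).2))
    (heev : ∀ x : F, ev (e x) = (0, (ev x).1)) (θ : ↥ℓ ≃ₗ[ℂ] ℂ × ℂ)
    (hθM : ∀ (m : M) (x : F) (hx : x ∈ ℓ) (hmx : r m x ∈ ℓ),
      θ ⟨r m x, hmx⟩ = (χ m * (θ ⟨x, hx⟩).1, -lam m * (χ m * (θ ⟨x, hx⟩).1) + χ m * (θ ⟨x, hx⟩).2))
    (hθE : ∀ (x : F) (hx : x ∈ ℓ) (hex : e x ∈ ℓ), θ ⟨e x, hex⟩ = (0, (θ ⟨x, hx⟩).1))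
    (m : M) {s : F} (hs : s ∈ ℓ) : r m s = χ m • s - (lam m * χ m) • e s := by
  have hms := apply_mem_openCell_of_mem r χ lam ev ℓ hℓ hev m hs
  have hes := e_mem_openCell_of_mem ev e ℓ hℓ heev hs
  have key : θ ⟨r m s, hms⟩ = θ (χ m • ⟨s, hs⟩ - (lam m * χ m) • ⟨e s, hes⟩) := by
    rw [hθM m s hs hms, map_sub, map_smul, map_smul, hθE s hs hes]
    refine Prod.ext ?_ ?_
    · simp only [Prod.fst_sub, Prod.smul_fst, smul_eq_mul, mul_zero, sub_zero]
    · simp only [Prod.snd_sub, Prod.smul_snd, smul_eq_mul]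
      ring
  have h := congrArg Subtype.val (θ.injective key)
  simpa using h

/-! ## §2 The section: `ev` splits `M`-equivariantly and `ε`-linearly -/

include hℓ in
/-- **THE `ℂ[ε][M]`-SECTION OF THE CLOSED-CELL FUNCTIONAL.**  Data: `r`, `χ` (unit-valued), `λ` additive, `ev` intertwining `r` with
`N₀⁺` and admitting a lift `x₁` of `(1, 0)`, `e` with `e² = 0`, `e ∘ r(m) = r(m) ∘ e`, `ev ∘ e = E ∘ ev`, and on `ℓ = ker ev` an `ε`-linear
`M`-isomorphism `θ : ℓ ≃ N₀⁻` (`hθM`, `hθE`).  Hypotheses: (hss) `F ∕ eF` is `χ`-isotypic — `r(m) x − χ(m) x ∈ eF`; (hsm) every vector is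
an eigenvector of an open subgroup (smoothness); (hrank) every additive `β : M → ℂ` vanishing on an open subgroup is `c · λ`.  THEN there is
`q ∈ F` with `ev q = (1, 0)` and **`r(m) q = χ(m) • (q + λ(m) • e q)`** for all `m` — i.e. `(w₁, w₂) ↦ w₁ q + w₂ e q` is an `M`-equivariant
`ε`-linear section of `ev`, and `F ≅ N₀⁻ ⊕ N₀⁺` over `ℂ[ε][M]`.  (The defect of any lift is `χ(m)β(m) e θ⁻¹(1,0)` with `β` additive and
locally zero, so `β = cλ`, and the shear `q := x₁ + (c∕2) θ⁻¹(1,0)` kills it.) [cite: Casselman1995, Lemma 7.1.1 (a); §6.4]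
[cite: BernsteinZelevinsky1977, Geometrical Lemma 2.12] [cite: Keys1984, §3 pp. 118–119] -/
theorem exists_jet_section (hχ : ∀ m, IsUnit (χ m)) (hlam : ∀ m m', lam (m * m') = lam m + lam m')
    (hev : ∀ (m : M) (x : F), ev (r m x) = (χ m * (ev x).1, lam m * (χ m * (ev x).1) + χ m * (ev x).2))
    (h1 : ∃ x₁ : F, ev x₁ = (1, 0))
    (hee : ∀ x : F, e (e x) = 0) (her : ∀ (m : M) (x : F), e (r m x) = r m (e x))
    (heev : ∀ x : F, ev (e x) = (0, (ev x).1)) (θ : ↥ℓ ≃ₗ[ℂ] ℂ × ℂ)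
    (hθM : ∀ (m : M) (x : F) (hx : x ∈ ℓ) (hmx : r m x ∈ ℓ),
      θ ⟨r m x, hmx⟩ = (χ m * (θ ⟨x, hx⟩).1, -lam m * (χ m * (θ ⟨x, hx⟩).1) + χ m * (θ ⟨x, hx⟩).2))
    (hθE : ∀ (x : F) (hx : x ∈ ℓ) (hex : e x ∈ ℓ), θ ⟨e x, hex⟩ = (0, (θ ⟨x, hx⟩).1))
    (hss : ∀ (m : M) (x : F), ∃ y : F, r m x - χ m • x = e y)
    (hsm : ∀ x : F, ∃ U : Subgroup M, IsOpen (U : Set M) ∧ ∀ m ∈ U, ∃ d : ℂ, r m x = d • x)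
    (hrank : ∀ β : M → ℂ, (∀ m m', β (m * m') = β m + β m') →
      (∃ U : Subgroup M, IsOpen (U : Set M) ∧ ∀ m ∈ U, β m = 0) → ∃ c : ℂ, ∀ m, β m = c * lam m) :
    ∃ q : F, ev q = (1, 0) ∧ ∀ m : M, r m q = χ m • (q + lam m • e q) := by
  obtain ⟨x₁, hx₁⟩ := h1
  have hℓr : ∀ (m : M) {x : F}, x ∈ ℓ → r m x ∈ ℓ := fun m x hx => apply_mem_openCell_of_mem r χ lam ev ℓ hℓ hev m hx
  have hℓe : ∀ {x : F}, x ∈ ℓ → e x ∈ ℓ := fun hx => e_mem_openCell_of_mem ev e ℓ hℓ heev hx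
  -- the open-cell generator `s₀ = θ⁻¹ (1, 0)` and `e s₀ = θ⁻¹ (0, 1)`
  set s₀ : ↥ℓ := θ.symm (1, 0) with hs₀def
  have hθs₀ : θ s₀ = (1, 0) := θ.apply_symm_apply _
  have hθs₀' : θ ⟨(s₀ : F), s₀.2⟩ = (1, 0) := by rw [Subtype.coe_eta]; exact hθs₀
  have hes₀ℓ : e (s₀ : F) ∈ ℓ := hℓe s₀.2
  have hθes₀ : θ ⟨e (s₀ : F), hes₀ℓ⟩ = (0, 1) := by rw [hθE _ s₀.2 hes₀ℓ, hθs₀']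
  have hes₀ne : e (s₀ : F) ≠ 0 := fun h => by
    have h0 : (⟨e (s₀ : F), hes₀ℓ⟩ : ↥ℓ) = 0 := Subtype.ext h
    have := hθes₀
    rw [h0, map_zero] at this
    exact zero_ne_one (congrArg Prod.snd this)
  have hrs₀ : ∀ m : M, r m (s₀ : F) = χ m • (s₀ : F) - (lam m * χ m) • e (s₀ : F) := fun m =>
    jacquet_apply_of_mem_openCell r χ lam ev e ℓ hℓ hev heev θ hθM hθE m s₀.2
  have hres₀ : ∀ m : M, r m (e (s₀ : F)) = χ m • e (s₀ : F) := fun m => by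
    rw [← her, hrs₀, map_sub, map_smul, map_smul, hee, smul_zero, sub_zero]
  -- the defect of the lift `x₁` is `χ(m)β(m) • e s₀`
  have key : ∀ m : M, ∃ b : ℂ, r m x₁ = χ m • (x₁ + lam m • e x₁ + b • e (s₀ : F)) := by
    intro m
    obtain ⟨y, hy⟩ := hss m x₁
    set y' : F := y - (lam m * χ m) • x₁ with hy'def
    have hd : r m x₁ - χ m • x₁ - (lam m * χ m) • e x₁ = e y' := by
      rw [hy'def, map_sub, map_smul, ← hy]
    have hevd : ev (e y') = 0 := by
      rw [← hd, map_sub, map_sub, map_smul, map_smul, hev, heev, hx₁]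
      ext <;> simp
    have hy'1 : (ev y').1 = 0 := by
      have h := hevd
      rw [heev] at h
      exact congrArg Prod.snd h
    set y'' : F := y' - (ev y').2 • e x₁ with hy''def
    have hy''ℓ : y'' ∈ ℓ := by
      rw [hℓ, hy''def, map_sub, map_smul, heev, hx₁]
      ext <;> simp [hy'1]
    have hey'' : e y'' = e y' := by
      rw [hy''def, map_sub, map_smul, hee, smul_zero, sub_zero]
    have hey''ℓ : e y'' ∈ ℓ := hℓe hy''ℓ
    refine ⟨(χ m)⁻¹ * (θ ⟨y'', hy''ℓ⟩).1, ?_⟩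
    have hcmp : e y'' = (θ ⟨y'', hy''ℓ⟩).1 • e (s₀ : F) := by
      have h2 : θ ⟨e y'', hey''ℓ⟩ = θ ((θ ⟨y'', hy''ℓ⟩).1 • ⟨e (s₀ : F), hes₀ℓ⟩) := by
        rw [hθE y'' hy''ℓ hey''ℓ, map_smul, hθes₀]
        ext <;> simp
      simpa using congrArg Subtype.val (θ.injective h2)
    rw [← hey'', hcmp, sub_sub, sub_eq_iff_eq_add] at hd
    rw [hd, smul_add, smul_add, smul_smul, smul_smul, mul_inv_cancel_left₀ (hχ m).ne_zero]
    module
  choose β hβ using key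
  have hrex₁ : ∀ m : M, r m (e x₁) = χ m • e x₁ := fun m => by
    rw [← her, hβ m, map_smul, map_add, map_add, map_smul, map_smul, hee, hee, smul_zero, smul_zero, add_zero, add_zero]
  -- `β` is additive
  have hβadd : ∀ m m' : M, β (m * m') = β m + β m' := by
    intro m m'
    have eq1 : r (m * m') x₁ = χ (m * m') • (x₁ + lam (m * m') • e x₁ + β (m * m') • e (s₀ : F)) := hβ (m * m')
    have eq2 : r (m * m') x₁ = χ m' • (χ m • (x₁ + lam m • e x₁ + β m • e (s₀ : F)) + lam m' • (χ m • e x₁) +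
        β m' • (χ m • e (s₀ : F))) := by
      rw [map_mul, Module.End.mul_apply, hβ m', map_smul, map_add, map_add, map_smul, map_smul, hβ m, hrex₁, hres₀]
    have h3 : ((χ m * χ m') * (β (m * m') - (β m + β m'))) • e (s₀ : F) = 0 := by
      have h4 : ((χ m * χ m') * (β (m * m') - (β m + β m'))) • e (s₀ : F) =
          χ (m * m') • (x₁ + lam (m * m') • e x₁ + β (m * m') • e (s₀ : F)) -
            χ m' • (χ m • (x₁ + lam m • e x₁ + β m • e (s₀ : F)) + lam m' • (χ m • e x₁) + β m' • (χ m • e (s₀ : F))) := by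
        rw [map_mul, hlam]
        module
      rw [h4, ← eq1, ← eq2, sub_self]
    have h5 := (smul_eq_zero.1 h3).resolve_right hes₀ne
    have h6 : β (m * m') - (β m + β m') = 0 := (mul_eq_zero.1 h5).resolve_left (mul_ne_zero (hχ m).ne_zero (hχ m').ne_zero)
    exact sub_eq_zero.1 h6
  -- `β` vanishes on the stabiliser of `x₁`
  have hβloc : ∃ U : Subgroup M, IsOpen (U : Set M) ∧ ∀ m ∈ U, β m = 0 := by
    obtain ⟨U, hU, hUst⟩ := hsm x₁
    refine ⟨U, hU, fun m hm => ?_⟩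
    obtain ⟨d, hd⟩ := hUst m hm
    have h := hβ m
    rw [hd] at h
    have hev1 := congrArg ev h
    rw [map_smul, hx₁, map_smul, map_add, map_add, map_smul, map_smul, heev, hx₁, (hℓ _).1 hes₀ℓ] at hev1
    have hfst := congrArg Prod.fst hev1
    have hsnd := congrArg Prod.snd hev1
    simp only [Prod.smul_mk, Prod.mk_add_mk, smul_eq_mul, mul_one, mul_zero, add_zero, zero_add, smul_zero] at hfst hsnd
    -- `hfst : d = χ m`, `hsnd : 0 = χ m * lam m`
    have hlam0 : lam m = 0 := by
      rcases mul_eq_zero.1 hsnd.symm with h0 | h0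
      · exact absurd h0 (hχ m).ne_zero
      · exact h0
    rw [hfst, hlam0, zero_smul, add_zero, smul_add] at h
    have h7 : χ m • (β m • e (s₀ : F)) = 0 := by
      have h8 := h
      rw [left_eq_add] at h8
      exact h8
    rw [smul_smul] at h7
    have h9 := (smul_eq_zero.1 h7).resolve_right hes₀ne
    exact (mul_eq_zero.1 h9).resolve_left (hχ m).ne_zero
  obtain ⟨c, hc⟩ := hrank β hβadd hβloc
  -- the shear `q := x₁ + (c / 2) • s₀`
  refine ⟨x₁ + (c / 2) • (s₀ : F), ?_, fun m => ?_⟩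
  · rw [map_add, map_smul, hx₁, (hℓ _).1 s₀.2, smul_zero, add_zero]
  · rw [map_add, map_smul, hβ m, hc m, hrs₀ m, map_add, map_smul]
    module

/-! ## §3 The retraction `φ : F → N₀⁻` extending `θ` -/

include hℓ in
/-- **THE `M`-EQUIVARIANT `ε`-LINEAR RETRACTION ONTO THE OPEN-CELL PART.**  Under the hypotheses of `exists_jet_section` there is a linear
`φ : F → ℂ × ℂ` with (i) `φ (r(m) x) = N₀⁻(m) (φ x)` where `N₀⁻(m)(w₁, w₂) = (χ w₁, −λχ w₁ + χ w₂)`, (ii) `φ (e x) = (0, (φ x).1)` (`ε`-linearity)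
and (iii) `φ = θ` on `ℓ`.  (`φ := θ ∘ (1 − L ∘ ev)` with `L (w₁, w₂) = w₁ q + w₂ e q` the section of §2: `1 − L ∘ ev` is the `ℂ[ε][M]`-projection
onto `ℓ` along the complement `L(ℂ × ℂ) ≅ N₀⁺`.)  By Frobenius reciprocity this is the `M`-datum of an `ε`-linear `G`-map `X⁺ → X⁻` of jet
modules — the first-order jet of the normalised intertwining operator. [cite: Casselman1995, Lemma 7.1.1 (a); §6.4]
[cite: BernsteinZelevinsky1977, Geometrical Lemma 2.12] [cite: Keys1984, §3 pp. 118–119] -/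
theorem exists_jet_retraction (hχ : ∀ m, IsUnit (χ m)) (hlam : ∀ m m', lam (m * m') = lam m + lam m')
    (hev : ∀ (m : M) (x : F), ev (r m x) = (χ m * (ev x).1, lam m * (χ m * (ev x).1) + χ m * (ev x).2))
    (h1 : ∃ x₁ : F, ev x₁ = (1, 0))
    (hee : ∀ x : F, e (e x) = 0) (her : ∀ (m : M) (x : F), e (r m x) = r m (e x))
    (heev : ∀ x : F, ev (e x) = (0, (ev x).1)) (θ : ↥ℓ ≃ₗ[ℂ] ℂ × ℂ)
    (hθM : ∀ (m : M) (x : F) (hx : x ∈ ℓ) (hmx : r m x ∈ ℓ),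
      θ ⟨r m x, hmx⟩ = (χ m * (θ ⟨x, hx⟩).1, -lam m * (χ m * (θ ⟨x, hx⟩).1) + χ m * (θ ⟨x, hx⟩).2))
    (hθE : ∀ (x : F) (hx : x ∈ ℓ) (hex : e x ∈ ℓ), θ ⟨e x, hex⟩ = (0, (θ ⟨x, hx⟩).1))
    (hss : ∀ (m : M) (x : F), ∃ y : F, r m x - χ m • x = e y)
    (hsm : ∀ x : F, ∃ U : Subgroup M, IsOpen (U : Set M) ∧ ∀ m ∈ U, ∃ d : ℂ, r m x = d • x)
    (hrank : ∀ β : M → ℂ, (∀ m m', β (m * m') = β m + β m') →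
      (∃ U : Subgroup M, IsOpen (U : Set M) ∧ ∀ m ∈ U, β m = 0) → ∃ c : ℂ, ∀ m, β m = c * lam m) :
    ∃ φ : F →ₗ[ℂ] ℂ × ℂ,
      (∀ (m : M) (x : F), φ (r m x) = (χ m * (φ x).1, -lam m * (χ m * (φ x).1) + χ m * (φ x).2)) ∧
      (∀ x : F, φ (e x) = (0, (φ x).1)) ∧
      ∀ (x : F) (hx : x ∈ ℓ), φ x = θ ⟨x, hx⟩ := by
  obtain ⟨q, hq1, hq⟩ := exists_jet_section r χ lam ev e ℓ hℓ hχ hlam hev h1 hee her heev θ hθM hθE hss hsm hrank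
  have hℓr : ∀ (m : M) {x : F}, x ∈ ℓ → r m x ∈ ℓ := fun m x hx => apply_mem_openCell_of_mem r χ lam ev ℓ hℓ hev m hx
  have hℓe : ∀ {x : F}, x ∈ ℓ → e x ∈ ℓ := fun hx => e_mem_openCell_of_mem ev e ℓ hℓ heev hx
  have hreq : ∀ m : M, r m (e q) = χ m • e q := fun m => by
    rw [← her, hq m, map_smul, map_add, map_smul, hee, smul_zero, add_zero]
  -- the section `L (w₁, w₂) = w₁ q + w₂ e q`
  let L : ℂ × ℂ →ₗ[ℂ] F := (LinearMap.fst ℂ ℂ ℂ).smulRight q + (LinearMap.snd ℂ ℂ ℂ).smulRight (e q)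
  have hL : ∀ w : ℂ × ℂ, L w = w.1 • q + w.2 • e q := fun w => rfl
  have hevL : ∀ w : ℂ × ℂ, ev (L w) = w := fun w => by
    rw [hL, map_add, map_smul, map_smul, heev, hq1]
    ext <;> simp
  have hrL : ∀ (m : M) (w : ℂ × ℂ), r m (L w) = L (χ m * w.1, lam m * (χ m * w.1) + χ m * w.2) := fun m w => by
    rw [hL, hL, map_add, map_smul, map_smul, hq m, hreq m]
    module
  have heL : ∀ w : ℂ × ℂ, e (L w) = L (0, w.1) := fun w => by
    rw [hL, hL, map_add, map_smul, map_smul, hee, smul_zero, add_zero, zero_smul, zero_add]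
  -- the projection `ψ₀ := 1 − L ∘ ev` onto `ℓ`
  have hψ₀mem : ∀ x : F, ((LinearMap.id : F →ₗ[ℂ] F) - L ∘ₗ ev) x ∈ ℓ := fun x => by
    rw [hℓ, LinearMap.sub_apply, LinearMap.id_apply, LinearMap.comp_apply, map_sub, hevL, sub_self]
  let ψ₀ : F →ₗ[ℂ] ↥ℓ := LinearMap.codRestrict ℓ ((LinearMap.id : F →ₗ[ℂ] F) - L ∘ₗ ev) hψ₀mem
  have hψ₀v : ∀ x : F, (ψ₀ x : F) = x - L (ev x) := fun x => rfl
  refine ⟨θ.toLinearMap ∘ₗ ψ₀, fun m x => ?_, fun x => ?_, fun x hx => ?_⟩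
  · have hmem : r m (ψ₀ x : F) ∈ ℓ := hℓr m (ψ₀ x).2
    have heq : (⟨r m (ψ₀ x : F), hmem⟩ : ↥ℓ) = ψ₀ (r m x) := Subtype.ext (by
      change r m (x - L (ev x)) = r m x - L (ev (r m x))
      rw [map_sub, hrL, hev])
    have h := hθM m (ψ₀ x : F) (ψ₀ x).2 hmem
    rw [heq, Subtype.coe_eta] at h
    exact h
  · have hmem : e (ψ₀ x : F) ∈ ℓ := hℓe (ψ₀ x).2
    have heq : (⟨e (ψ₀ x : F), hmem⟩ : ↥ℓ) = ψ₀ (e x) := Subtype.ext (by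
      change e (x - L (ev x)) = e x - L (ev (e x))
      rw [map_sub, heL, heev])
    have h := hθE (ψ₀ x : F) (ψ₀ x).2 hmem
    rw [heq, Subtype.coe_eta] at h
    exact h
  · have heq : ψ₀ x = ⟨x, hx⟩ := Subtype.ext (by rw [hψ₀v, (hℓ x).1 hx, map_zero, sub_zero])
    change θ (ψ₀ x) = θ ⟨x, hx⟩
    rw [heq]

/-! ## §4 Rigidity: an `ε`-linear `M`-map `F → N₀⁺` has first row a multiple of `ev` -/

omit [TopologicalSpace M] in
include hℓ in
/-- **«`Hom_{ℂ[ε][M]}(J⁻, J⁺) ⊆ ε`» ⇒ THE FIRST ROW OF AN `ε`-LINEAR `M`-MAP `F → N₀⁺` IS A MULTIPLE OF `ev`.**  Let `ψ : F → ℂ × ℂ` be linear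
with `ψ (r(m) x) = N₀⁺(m)(ψ x)` and `ψ (e x) = (0, (ψ x).1)`; assume `λ(m₀) ≠ 0` for some `m₀`, `χ` unit-valued, `ev` surjective onto `(1, 0)`,
and the open-cell isomorphism `θ : ℓ ≃ N₀⁻` (`hθM`, `hθE`).  Then there is `r₀ ∈ ℂ` with **`(ψ x).1 = r₀ · (ev x).1`** for all `x`.  (On
`ℓ`, `r(m₀) s = χ s − λχ e s` forces `2λ(m₀)χ(m₀) (ψ s).1 = 0`; off `ℓ`, `x − (ev x).1 x₁ − (ev x).2 e x₁ ∈ ℓ`.)  In the application: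
every `ε`-linear `G`-endomorphism of the jet module `i_P(N₀⁺)` reduces modulo `ε` to a SCALAR on `i_P(χ)`.
[cite: BernsteinZelevinsky1977, Geometrical Lemma 2.12; §2.3] [cite: Casselman1995, §6.4] [cite: Keys1984, §3 pp. 118–119] -/
theorem fst_eq_mul_fst_of_jet_linear (hχ : ∀ m, IsUnit (χ m)) (hne : ∃ m, lam m ≠ 0)
    (hev : ∀ (m : M) (x : F), ev (r m x) = (χ m * (ev x).1, lam m * (χ m * (ev x).1) + χ m * (ev x).2))
    (h1 : ∃ x₁ : F, ev x₁ = (1, 0))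
    (heev : ∀ x : F, ev (e x) = (0, (ev x).1)) (θ : ↥ℓ ≃ₗ[ℂ] ℂ × ℂ)
    (hθM : ∀ (m : M) (x : F) (hx : x ∈ ℓ) (hmx : r m x ∈ ℓ),
      θ ⟨r m x, hmx⟩ = (χ m * (θ ⟨x, hx⟩).1, -lam m * (χ m * (θ ⟨x, hx⟩).1) + χ m * (θ ⟨x, hx⟩).2))
    (hθE : ∀ (x : F) (hx : x ∈ ℓ) (hex : e x ∈ ℓ), θ ⟨e x, hex⟩ = (0, (θ ⟨x, hx⟩).1))
    (ψ : F →ₗ[ℂ] ℂ × ℂ)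
    (hψM : ∀ (m : M) (x : F), ψ (r m x) = (χ m * (ψ x).1, lam m * (χ m * (ψ x).1) + χ m * (ψ x).2))
    (hψE : ∀ x : F, ψ (e x) = (0, (ψ x).1)) :
    ∃ r₀ : ℂ, ∀ x : F, (ψ x).1 = r₀ * (ev x).1 := by
  obtain ⟨m₀, hm₀⟩ := hne
  obtain ⟨x₁, hx₁⟩ := h1
  -- on `ℓ` the first coordinate of `ψ` vanishes
  have hℓ0 : ∀ {s : F}, s ∈ ℓ → (ψ s).1 = 0 := by
    intro s hs
    have hrs := jacquet_apply_of_mem_openCell r χ lam ev e ℓ hℓ hev heev θ hθM hθE m₀ hs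
    have h := hψM m₀ s
    rw [hrs, map_sub, map_smul, map_smul, hψE] at h
    have h2 := congrArg Prod.snd h
    simp only [Prod.snd_sub, Prod.smul_snd, smul_eq_mul] at h2
    -- `h2 : χ m₀ * (ψ s).2 - lam m₀ * χ m₀ * (ψ s).1 = lam m₀ * (χ m₀ * (ψ s).1) + χ m₀ * (ψ s).2`
    have h3 : (2 * (lam m₀ * χ m₀)) * (ψ s).1 = 0 := by linear_combination -h2
    rcases mul_eq_zero.1 h3 with h4 | h4
    · exact absurd h4 (mul_ne_zero two_ne_zero (mul_ne_zero hm₀ (hχ m₀).ne_zero))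
    · exact h4
  refine ⟨(ψ x₁).1, fun x => ?_⟩
  have hmem : x - (ev x).1 • x₁ - (ev x).2 • e x₁ ∈ ℓ := by
    rw [hℓ, map_sub, map_sub, map_smul, map_smul, heev, hx₁]
    ext <;> simp
  have h := hℓ0 hmem
  rw [map_sub, map_sub, map_smul, map_smul, hψE] at h
  simp only [Prod.fst_sub, Prod.smul_fst, smul_eq_mul, mul_zero, sub_zero] at h
  linear_combination h

/-! ## §5 No lift: a `χ`-isotypic module maps into `εN₀⁺` -/

omit [TopologicalSpace M] in
/-- **NO LIFT.**  If `M` acts on `F′` through the character `χ` (`r′(m) u = χ(m) u`) and `μ : F′ → ℂ × ℂ` intertwines `r′` with the jet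
character `N₀⁺(m)(w₁, w₂) = (χ w₁, λχ w₁ + χ w₂)` with `λ(m₀) ≠ 0` for some `m₀` (and `χ` unit-valued), then `(μ u).1 = 0` for all `u`:
`Hom_M(χ, N₀⁺) = εN₀⁺ = 0 × ℂ`.  By Frobenius reciprocity: a representation whose Jacquet module is `χ`-isotypic admits no `G`-map to the
jet module `i_P(N₀⁺)` that is non-zero modulo `ε` — «`i_P(χ)` does not lift to first order along a non-trivial unramified twist».
[cite: BernsteinZelevinsky1977, §2.3] [cite: Keys1984, §3 pp. 118–119] -/
theorem fst_eq_zero_of_jacquet_isotypic {F' : Type*} [AddCommGroup F'] [Module ℂ F'] (r' : Representation ℂ M F')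
    (hχ : ∀ m, IsUnit (χ m)) (hne : ∃ m, lam m ≠ 0) (hss' : ∀ (m : M) (u : F'), r' m u = χ m • u) (μ : F' →ₗ[ℂ] ℂ × ℂ)
    (hμ : ∀ (m : M) (u : F'), μ (r' m u) = (χ m * (μ u).1, lam m * (χ m * (μ u).1) + χ m * (μ u).2)) (u : F') :
    (μ u).1 = 0 := by
  obtain ⟨m, hm⟩ := hne
  have h := congrArg Prod.snd (hμ m u)
  rw [hss', map_smul, Prod.smul_snd, smul_eq_mul] at h
  have h' : lam m * (χ m * (μ u).1) = 0 := by linear_combination -h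
  rcases mul_eq_zero.1 h' with h1 | h2
  · exact absurd h1 hm
  · rcases mul_eq_zero.1 h2 with h3 | h4
    · exact absurd h3 (hχ m).ne_zero
    · exact h4

end JetExtension

end Literature.RepresentationTheory
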